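import Literature.MathematicalPhysics.QuantumFieldTheory.Balaban1983to89.B8Thm4UniqueELan
import Literature.MathematicalPhysics.QuantumFieldTheory.Balaban1983to89.T4TermwiseTorus

/-!
# `Balaban1983to89.B8Thm4UniqueELanPer` — [Balaban1985RegularSpaces] THEOREM 4 (p. 88) ∕ THEOREM 8 (p. 101), UNIQUENESS CLAUSE `u₁ = u₂` FOR **PERIODIC** COMPETITORS,
# ARBITRARY GAUGE PREDICATE `Lan`, MODULO PROPOSITION 5's UNIQUENESS (1.109) ASKED AT **PERIODIC** ARGUMENTS ONLY — dag-n05-c's `B8Thm4UniqueELan.thm4_unique_eq_lanE` re-run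
# with the periodicity thread (brick T4a of the periodic-argument edition of Theorems 2 ∕ 4 ∕ 8)

statement-level skeleton of published theorems with citation tags; proofs where landed; nothing here is a claim about the Yang–Mills mass gap

T. Bałaban, *Spaces of regular gauge field configurations on a lattice and gauge fixing conditions*, Commun. Math. Phys. **99** (1985) 75–102
`[Balaban1985RegularSpaces]` ("B8"): Thm 4 p. 88 («exactly one gauge transformation u»), Thm 8 (1.146) p. 101, proof p. 95 (the uniqueness paragraph after (1.112)), Prop. 5 (1.107)–(1.109) p. 94,
(1.29) p. 81, (1.62) p. 87, p. 77 («Ω_j ⊂ T_η»).  `[Balaban1985Averaging]` (4) p. 18 (the torus).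

## WHY THIS FILE (cell `pub-ymgap`, HUMAN RULING D-0062; width seat `pub-ymgap-dag-n05-w1` (g4); brick T4a of the package «N05-(β′)-GT», plan g87 SCOPE WORD v2 2026-08-28 15:56Z «GO TO FILE»;
## director-ym №217 (1)(b))

The uniqueness half of Theorem 4's member core asks Proposition 5's uniqueness clause `hP5u` — quantified in `B8Thm4UniqueELan` over ALL competitor pairs `(v, w)` and their logarithms
`(λ, μ)` on `ℤᵈ` — EXACTLY ONCE, at `v := u₁⁻¹u₂`, `w := 1`, `λ := i⁻¹ log(u₁⁻¹u₂)` (sitewise), `μ := 0` (print p. 95: «u′ = u₁⁻¹u₂ is a solution of (1.107) … hence u′ = 1»).  For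
`P`-PERIODIC `u₁`, `u₂` these four are `P`-periodic, so the PERIODIC-GUARDED uniqueness socket (Proposition 5's «exactly one λ′» among PERIODIC competitors — what cell `lit-balaban`'s torus
Prop-5 uniqueness `B8Prop5UniqSectEWPer.hFP_unique_of_sectE_local_wb_per` supplies at `Ω ≡ T_η`) suffices: THIS FILE is that re-run — uniqueness among periodic competitors from
the guarded socket; everything else (towers `lam_in_domain_of_agree`, off-`Ω₀` `lam_zero_off`, bonds `ineq1109_scaled`) BY NAME, unchanged.

## WHAT IS PROVED (kernel, 0 sorry, 0 def)

★★ `thm4_unique_eq_lanE_per` — `B8Thm4UniqueELan.thm4_unique_eq_lanE` VERBATIM with `(P : ℕ) (hu₁p : IsPeriodic P u₁) (hu₂p : IsPeriodic P u₂)` and the socket `hP5u` GUARDED by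
`IsPeriodic P v → IsPeriodic P w → IsPeriodic P lam → IsPeriodic P mu →`; conclusion `u₁ = u₂`; FOUR new one-line `have`s (the periodicity of `u₁⁻¹u₂`, `1`, `i⁻¹ log(u₁⁻¹u₂)`, `0`).

## HONEST SCOPE

A re-run of a LANDED assembly with one periodicity thread; Proposition 5 (1.109) is NOT proved (the socket, now askable at periodic competitors); count-neutral helper (K1⁹
`stmt-QuantumFields-27364`); N05 NOT discharged; no count claim; one finite `𝕋⁴` programme at fixed `ε`, Bałaban AS PRINTED; the Yang–Mills mass gap (Clay) is NOT proved by any of this —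
R4 closes the conditional finite-`𝕋⁴` rung `BalabanLadder.UV` only; nothing continuum ∕ ℝ⁴ ∕ OS.  No `sorry`, no `def`, no `instance`, no `notation`.  Unit `pub-ymgap-dag-n05-w1` (g4), 2026-08-28.

[cite: Balaban1985RegularSpaces, Thm 4 p.88, Thm 8 p.101, proof p.95 (1.112), (1.29) p.81, (1.62) p.87, Prop. 5 (1.107)–(1.109) p.94, p.77; Balaban1985Averaging, (4) p.18]
-/

noncomputable section

open NormedSpace

namespace Literature.MathematicalPhysics.QuantumFieldTheory.Balaban1983to89.B8Thm4UniqueELanPer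

open Complex (I I_ne_zero)
open MatrixLog B7Prop1Explicit B7Prop2Explicit B7Prop1Local B7Eq92Concrete
open B7Prop2Explicit (C0 c2')
open B7Prop3Flat (c3)
open B8Ineq130 (tlo thi)
open B8Ineq132 (covDerivFwd InAk)
open B8Eq119TwistedAxial (InAx Restr129)
open B8Eq184Proof (gaugeExp cfgExp)
open B8Eq140Level (SideTouches sideTouches_of_bondTouches)
open B8Ineq1109Local (ineq1109_scaled lam_of_unit mgauge_quotient_eq)
open B8Thm4UniqueLocal (lam_in_domain_of_agree)
open B8Thm4AtLandau138 (pdevOn_tower_lt_of_inAk mgauge_mgauge_inv)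
open B8Thm4UniqueE (quotient_eq_one_off lam_zero_off)
open T4TermwiseTorus (IsPeriodic)

-- `Site` alone could resolve to the torus sites of `Setup.lean`; re-export the `ℤ^d` sites of `B7Prop1Explicit`.
export B7Prop1Explicit (Site)

variable {d : ℕ}

section Main

variable {𝔸 : Type*} [CStarAlgebra 𝔸] [Nontrivial 𝔸]
variable {L k : ℕ} {η : ℝ} {Ω : ℕ → Set (Site d)} {Λ : ℕ → Set (Site d)} {U₀ U' : Site d → Fin d → 𝔸ˣ} {α₀ αP c : ℝ}
  {u₁ u₂ : Site d → 𝔸ˣ}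

/-- ★★ **THEOREM 4's ∕ THEOREM 8's UNIQUENESS CLAUSE `u₁ = u₂` FOR `P`-PERIODIC COMPETITORS, FROM PROPOSITION 5's UNIQUENESS ASKED AT PERIODIC ARGUMENTS ONLY** —
`B8Thm4UniqueELan.thm4_unique_eq_lanE` re-run: the one socket call is at `(u₁⁻¹u₂, 1, i⁻¹ log(u₁⁻¹u₂), 0)`, all `P`-periodic when `u₁`, `u₂` are (print's torus `T_η`, p. 77); print's
paragraph p. 95 otherwise verbatim. [cite: Balaban1985RegularSpaces, Thm 4 p.88 («exactly one»), Thm 8 p.101, proof p.95 (1.112), (1.29) p.81, (1.62) p.87, Prop. 5 (1.107)–(1.109) p.94, p.77 («Ω_j ⊂ T_η»)] -/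
theorem thm4_unique_eq_lanE_per (hd2 : 2 ≤ d) (hL : 2 ≤ L) (hη : 0 < η)
    (hU₀ : ∀ x κ, U₀ x κ ∈ unitaryUnits 𝔸) (hU' : ∀ x κ, U' x κ ∈ unitaryUnits 𝔸)
    (hu₁ : ∀ x, u₁ x ∈ unitaryUnits 𝔸) (hu₂ : ∀ x, u₂ x ∈ unitaryUnits 𝔸)
    -- the torus read on `ℤᵈ`: the two competitors are `P`-periodic
    (P : ℕ) (hu₁p : IsPeriodic P u₁) (hu₂p : IsPeriodic P u₂)
    (hα : 0 < α₀) (hα3 : C0 d * α₀ ≤ 1 / 3) (hα4 : 4 * α₀ ≤ c2' d L) (hc : 0 ≤ c)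
    (hsmall : Real.exp (4 * (800 * ((d : ℝ) + 1) ^ 2 * ((d : ℝ) + 4)) * α₀) * (1 + 8 * (131072 * ((d : ℝ) + 1) ^ 2) * c) ≤ 2)
    (hc₃ : 2 * c ≤ c3 d L) (hsm : 2048 * (d : ℝ) * c ≤ 1) (hα₃ : 40 * d * c ≤ 1 / 5000)
    (hαP : 0 < αP) (hαP3 : C0 d * αP ≤ 1 / 3) (hαP2 : 2 * αP ≤ c2' d L)
    {cu : ℝ} (hcu₁ : 2 * (2 * (40 * d * c) + 2 * 1116 * (40 * d * c) ^ 2) < cu) (hcu₂ : 5 * c < cu)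
    (h33 : InAk L k η α₀ Ω U₀) (h34 : InAk L k η αP Ω (U' * U₀)) (hAx : InAx L k Λ U₀ (U' * U₀))
    (htower : ∀ j, j ≤ k → ∀ y ∈ Λ j, ∀ x, InBox (tlo L y j) (thi L y j) x → x ∈ Ω j)
    (h129₁ : Restr129 L k Λ U₀ u₁) (h129₂ : Restr129 L k Λ U₀ u₂)
    (Lan : (Site d → Fin d → 𝔸ˣ) → Prop)
    (hLan₁ : Lan (mgauge U₀ u₁⁻¹ U')) (hLan₂ : Lan (mgauge U₀ u₂⁻¹ U'))
    (h162₁ : ∃ A₁ : Site d → Fin d → 𝔸, ∀ j, j ≤ k → ∀ (x : Site d) (κ : Fin d), SideTouches (Ω j) x κ →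
      mgauge U₀ u₁⁻¹ U' x κ = cfgExp η A₁ x κ ∧ ‖A₁ x κ‖ ≤ c * ((L : ℝ) ^ j * η)⁻¹)
    (h162₂ : ∃ A₂ : Site d → Fin d → 𝔸, ∀ j, j ≤ k → ∀ (x : Site d) (κ : Fin d), SideTouches (Ω j) x κ →
      mgauge U₀ u₂⁻¹ U' x κ = cfgExp η A₂ x κ ∧ ‖A₂ x κ‖ ≤ c * ((L : ℝ) ^ j * η)⁻¹)
    (hP5u : ∀ (v w : Site d → 𝔸ˣ) (lam mu : Site d → 𝔸),
      IsPeriodic P v → IsPeriodic P w → IsPeriodic P lam → IsPeriodic P mu →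
      (∀ x, ((gaugeExp lam x : 𝔸ˣ) : 𝔸) = ((v x : 𝔸ˣ) : 𝔸) ∧ IsSelfAdjoint (lam x) ∧ ‖lam x‖ < cu) → (∀ x, x ∉ Ω 0 → lam x = 0) →
      (∀ j, j ≤ k → ∀ b ∈ {b : Site d × Fin d | SideTouches (Ω j) b.1 b.2}, ((L : ℝ) ^ j * η) * ‖covDerivFwd η U₀ b.2 lam b.1‖ < cu) →
      (∀ x, ((gaugeExp mu x : 𝔸ˣ) : 𝔸) = ((w x : 𝔸ˣ) : 𝔸) ∧ IsSelfAdjoint (mu x) ∧ ‖mu x‖ < cu) → (∀ x, x ∉ Ω 0 → mu x = 0) →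
      (∀ j, j ≤ k → ∀ b ∈ {b : Site d × Fin d | SideTouches (Ω j) b.1 b.2}, ((L : ℝ) ^ j * η) * ‖covDerivFwd η U₀ b.2 mu b.1‖ < cu) →
      Lan (mgauge U₀ v⁻¹ (mgauge U₀ u₁⁻¹ U')) → Restr129 L k Λ U₀ (u₁ * v) →
      Lan (mgauge U₀ w⁻¹ (mgauge U₀ u₁⁻¹ U')) → Restr129 L k Λ U₀ (u₁ * w) →
      ∀ x, v x = w x)
    (hpart : ∀ x, x ∈ Ω 0 → ∃ j, j ≤ k ∧ ∃ y ∈ Λ j, InBox (tlo L y j) (thi L y j) x)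
    (hu₁S : ∀ x, x ∉ Ω 0 → u₁ x = 1) (hu₂S : ∀ x, x ∉ Ω 0 → u₂ x = 1) :
    u₁ = u₂ := by
  have hL1 : 1 ≤ L := le_trans (by norm_num) hL
  have hd : 1 ≤ d := le_trans (by norm_num) hd2
  have hd' : (1 : ℝ) ≤ d := by exact_mod_cast hd
  haveI : Nontrivial (Fin d) := Fin.nontrivial_iff_two_le.mpr hd2
  obtain ⟨A₁, hA₁⟩ := h162₁
  obtain ⟨A₂, hA₂⟩ := h162₂
  -- the two gauge-fixed fields `U_i = U′^{u_i⁻¹}` as opaque names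
  obtain ⟨U₁, hU₁def⟩ : ∃ U₁ : Site d → Fin d → 𝔸ˣ, U₁ = mgauge U₀ u₁⁻¹ U' := ⟨_, rfl⟩
  obtain ⟨U₂, hU₂def⟩ : ∃ U₂ : Site d → Fin d → 𝔸ˣ, U₂ = mgauge U₀ u₂⁻¹ U' := ⟨_, rfl⟩
  have h₁ : mgauge U₀ u₁ U₁ = U' := by rw [hU₁def]; exact mgauge_mgauge_inv U₀ U' u₁
  have h₂ : mgauge U₀ u₂ U₂ = U' := by rw [hU₂def]; exact mgauge_mgauge_inv U₀ U' u₂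
  have hA₁' : ∀ j, j ≤ k → ∀ (x : Site d) (κ : Fin d), SideTouches (Ω j) x κ →
      U₁ x κ = cfgExp η A₁ x κ ∧ ‖A₁ x κ‖ ≤ c * ((L : ℝ) ^ j * η)⁻¹ := by rw [hU₁def]; exact hA₁
  have hA₂' : ∀ j, j ≤ k → ∀ (x : Site d) (κ : Fin d), SideTouches (Ω j) x κ →
      U₂ x κ = cfgExp η A₂ x κ ∧ ‖A₂ x κ‖ ≤ c * ((L : ℝ) ^ j * η)⁻¹ := by rw [hU₂def]; exact hA₂
  -- a bond inside a tower `Bʲ(y) ⊂ Ω_j` is a side of a plaquette touching `Ω_j`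
  have hside : ∀ j, j ≤ k → ∀ y ∈ Λ j, ∀ (x : Site d) (κ : Fin d), InBox (tlo L y j) (thi L y j) x →
      SideTouches (Ω j) x κ := by
    intro j hj y hy x κ hx
    obtain ⟨κ', hκ'⟩ := exists_ne κ
    exact sideTouches_of_bondTouches hκ' (Or.inl (htower j hj y hy x hx))
  -- the threshold bookkeeping of `B8Thm4UniqueLocal`
  have ha₃0 : 0 ≤ 40 * d * c := by positivity
  set a₃ : ℝ := 2 * (40 * d * c) + 2 * 1116 * (40 * d * c) ^ 2 with ha₃
  have ha₃nn : 0 ≤ a₃ := by rw [ha₃]; positivity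
  have hα₃' : 40 * d * c ≤ 1 / 3000 := hα₃.trans (by norm_num)
  have ha₃le : a₃ ≤ 1 / 2000 := by rw [ha₃]; nlinarith
  have hs : 2 * a₃ ≤ 1 / 1000 := by linarith
  have hc170 : ∀ j : ℕ, c * ((L : ℝ) ^ j)⁻¹ ≤ 1 / 170 := by
    intro j
    have hLr : (1 : ℝ) ≤ L := by exact_mod_cast hL1
    have hLj : (1 : ℝ) ≤ (L : ℝ) ^ j := one_le_pow₀ hLr
    have hinv : ((L : ℝ) ^ j)⁻¹ ≤ 1 := inv_le_one_of_one_le₀ hLj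
    have hc' : c ≤ 1 / 170 := by nlinarith
    calc c * ((L : ℝ) ^ j)⁻¹ ≤ c * 1 := mul_le_mul_of_nonneg_left hinv hc
      _ ≤ 1 / 170 := by linarith
  set lam : Site d → 𝔸 := fun z => (I⁻¹ : ℂ) • mlog ((((u₁⁻¹ * u₂) z : 𝔸ˣ)) : 𝔸) with hlam
  -- ON THE TOWERS: `lam_in_domain_of_agree` (sitewise clause and tower-internal gradients)
  have htw : ∀ j, j ≤ k → ∀ y ∈ Λ j, ∀ x : Site d, InBox (tlo L y j) (thi L y j) x →
      ((gaugeExp lam x : 𝔸ˣ) : 𝔸) = (((u₁⁻¹ * u₂) x : 𝔸ˣ) : 𝔸) ∧ IsSelfAdjoint (lam x) ∧ ‖lam x‖ ≤ 2 * a₃ := by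
    intro j hjk y hy x hx
    obtain ⟨he, hsa, hn, -⟩ := lam_in_domain_of_agree hd hL hL1 hη hU₀ hU' hu₁ hu₂ hα hα3 hα4 hc hsmall hc₃ hsm hα₃ hαP hαP3
      hαP2 hAx h129₁ h129₂ h₁ h₂ hjk hy
      (pdevOn_tower_lt_of_inAk hL1 hα h33 hjk (htower j hjk y hy))
      (pdevOn_tower_lt_of_inAk hL1 hαP h34 hjk (htower j hjk y hy))
      (fun x κ hx _ => (hA₁' j hjk x κ (hside j hjk y hy x κ hx)).1)
      (fun x κ hx _ => (hA₂' j hjk x κ (hside j hjk y hy x κ hx)).1)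
      (fun x κ hx _ => (hA₁' j hjk x κ (hside j hjk y hy x κ hx)).2)
      (fun x κ hx _ => (hA₂' j hjk x κ (hside j hjk y hy x κ hx)).2) x hx
    exact ⟨he, hsa, hn⟩
  -- AT EVERY SITE: a site of `Ω₀` lies in a tower (partition clause); off `Ω₀` the logarithm vanishes
  have hsite : ∀ x : Site d,
      ((gaugeExp lam x : 𝔸ˣ) : 𝔸) = (((u₁⁻¹ * u₂) x : 𝔸ˣ) : 𝔸) ∧ IsSelfAdjoint (lam x) ∧ ‖lam x‖ ≤ 2 * a₃ := by
    intro x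
    by_cases hx : x ∈ Ω 0
    · obtain ⟨j, hj, y, hy, hxy⟩ := hpart x hx
      exact htw j hj y hy x hxy
    · obtain ⟨h0, he⟩ := lam_zero_off hu₁S hu₂S hx
      refine ⟨he, ?_, ?_⟩
      · show IsSelfAdjoint (lam x)
        rw [hlam]
        simp only
        rw [h0]
        exact IsSelfAdjoint.zero 𝔸
      · show ‖lam x‖ ≤ 2 * a₃
        rw [hlam]
        simp only
        rw [h0, norm_zero]
        positivity
  have hoff : ∀ x, x ∉ Ω 0 → lam x = 0 := fun x hx => (lam_zero_off hu₁S hu₂S hx).1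
  -- AT EVERY BOND TOUCHING `Ω_j`: (1.112)'s bond estimate, fed by (1.62) at the bond and `|λ′| ≤ 2α₃′` at both endpoints
  have hq : mgauge U₀ (u₁⁻¹ * u₂)⁻¹ U₁ = U₂ := mgauge_quotient_eq U₀ u₁ u₂ U₁ U₂ U' h₁ h₂
  have hG : AvgClosed d L (unitaryUnits 𝔸) := avgClosed_unitaryUnits d L
  have hgrad : ∀ j, j ≤ k → ∀ b ∈ {b : Site d × Fin d | SideTouches (Ω j) b.1 b.2},
      ((L : ℝ) ^ j * η) * ‖covDerivFwd η U₀ b.2 lam b.1‖ ≤ 5 * c := by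
    intro j hj b hb
    obtain ⟨x, κ⟩ := b
    simp only [Set.mem_setOf_eq] at hb
    obtain ⟨hex, -, hnx⟩ := hsite x
    obtain ⟨hexe, -, hnxe⟩ := hsite (x + e κ)
    have hux : gaugeExp lam x = (u₁⁻¹ * u₂) x := Units.ext hex
    have huxe : gaugeExp lam (x + e κ) = (u₁⁻¹ * u₂) (x + e κ) := Units.ext hexe
    obtain ⟨hE₁, h62₁⟩ := hA₁' j hj x κ hb
    obtain ⟨hE₂, h62₂⟩ := hA₂' j hj x κ hb
    have hU₁₂ : mgauge U₀ (fun z => (gaugeExp lam z)⁻¹) (cfgExp η A₁) x κ = cfgExp η A₂ x κ := by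
      rw [← hE₂, ← hq, mgauge_apply, mgauge_apply, hux, huxe, Pi.inv_apply, Pi.inv_apply, hE₁]
    have hUx : U₀ x κ ∈ U1 𝔸 := hG.le_U1 (hU₀ x κ)
    exact ineq1109_scaled hη U₀ A₁ A₂ κ hUx hL1 hs hnx hnxe h62₁ h62₂ (hc170 j) hU₁₂
  -- the competitor `u′ = e^{iλ′}` in the socket's currency
  have hcu : 0 < cu := lt_of_le_of_lt (by positivity) hcu₂
  have hdom : ∀ x, ((gaugeExp lam x : 𝔸ˣ) : 𝔸) = (((u₁⁻¹ * u₂) x : 𝔸ˣ) : 𝔸) ∧ IsSelfAdjoint (lam x) ∧ ‖lam x‖ < cu := by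
    intro x
    obtain ⟨he, hsa, hn⟩ := hsite x
    exact ⟨he, hsa, lt_of_le_of_lt hn hcu₁⟩
  have hdomD : ∀ j, j ≤ k → ∀ b ∈ {b : Site d × Fin d | SideTouches (Ω j) b.1 b.2},
      ((L : ℝ) ^ j * η) * ‖covDerivFwd η U₀ b.2 lam b.1‖ < cu :=
    fun j hj b hb => lt_of_le_of_lt (hgrad j hj b hb) hcu₂
  -- the competitor `1 = e^{i0}`
  have hdom1 : ∀ x, ((gaugeExp (fun _ => (0 : 𝔸)) x : 𝔸ˣ) : 𝔸) = (((1 : Site d → 𝔸ˣ) x : 𝔸ˣ) : 𝔸) ∧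
      IsSelfAdjoint ((fun _ => (0 : 𝔸)) x) ∧ ‖(fun _ => (0 : 𝔸)) x‖ < cu := by
    intro x
    refine ⟨?_, IsSelfAdjoint.zero 𝔸, by simpa using hcu⟩
    rw [gaugeExp, smul_zero, B7Prop8Flat.expUnit_zero, Pi.one_apply]
  have hoff1 : ∀ x, x ∉ Ω 0 → (fun _ => (0 : 𝔸)) x = 0 := fun _ _ => rfl
  have hdomD1 : ∀ j, j ≤ k → ∀ b ∈ {b : Site d × Fin d | SideTouches (Ω j) b.1 b.2},
      ((L : ℝ) ^ j * η) * ‖covDerivFwd η U₀ b.2 (fun _ => (0 : 𝔸)) b.1‖ < cu := by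
    intro j _ b _
    have h0 : covDerivFwd η U₀ b.2 (fun _ => (0 : 𝔸)) b.1 = 0 := by
      rw [covDerivFwd, B7Eq78Linearization.conjR_apply, mul_zero, zero_mul, sub_zero, smul_zero]
    rw [h0, norm_zero, mul_zero]
    exact hcu
  -- `u′` solves (1.107): `U₁^{u′⁻¹} = U₂` is in the Landau gauge, `u₁u′ = u₂` satisfies (1.29); so does `1`
  have hLan' : Lan (mgauge U₀ (u₁⁻¹ * u₂)⁻¹ (mgauge U₀ u₁⁻¹ U')) := by
    rw [← hU₁def, hq, hU₂def]; exact hLan₂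
  have h129' : Restr129 L k Λ U₀ (u₁ * (u₁⁻¹ * u₂)) := by rw [mul_inv_cancel_left]; exact h129₂
  have hLan1 : Lan (mgauge U₀ (1 : Site d → 𝔸ˣ)⁻¹ (mgauge U₀ u₁⁻¹ U')) := by
    have h1 : mgauge U₀ (1 : Site d → 𝔸ˣ)⁻¹ (mgauge U₀ u₁⁻¹ U') = mgauge U₀ u₁⁻¹ U' := by
      funext x κ
      simp [mgauge_apply]
    rw [h1]; exact hLan₁
  have h1291 : Restr129 L k Λ U₀ (u₁ * 1) := by rw [mul_one]; exact h129₁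
  -- THE PERIODICITY THREAD: the two competitors handed to Proposition 5's uniqueness and their logarithms are `P`-periodic
  have hvp : IsPeriodic P (u₁⁻¹ * u₂) := fun x m => by simp only [Pi.mul_apply, Pi.inv_apply, hu₁p x m, hu₂p x m]
  have hlamp : IsPeriodic P lam := fun x m => by simp only [hlam, Pi.mul_apply, Pi.inv_apply, hu₁p x m, hu₂p x m]
  have h1p : IsPeriodic P (1 : Site d → 𝔸ˣ) := fun _ _ => rfl
  have h0p : IsPeriodic P (fun _ : Site d => (0 : 𝔸)) := fun _ _ => rfl
  have huniq := hP5u (u₁⁻¹ * u₂) 1 lam (fun _ => 0) hvp h1p hlamp h0p hdom hoff hdomD hdom1 hoff1 hdomD1 hLan' h129' hLan1 h1291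
  funext x
  have h := huniq x
  rw [Pi.mul_apply, Pi.inv_apply, Pi.one_apply, inv_mul_eq_one] at h
  exact h

end Main

end Literature.MathematicalPhysics.QuantumFieldTheory.Balaban1983to89.B8Thm4UniqueELanPer

end
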